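import Literature.MathematicalPhysics.QuantumLattice.FermionBlockProductState
import Literature.MathematicalPhysics.QuantumLattice.PeriodicInteractionsCellEnergy
import Literature.MathematicalPhysics.QuantumLattice.FermionLocalHamiltonianCovariance
import HarnessLib

/-!
# The periodic product of ONE even box state over a RECTANGULAR box tiling `ℓ_q(v) + [0,q+1)` of `ℤ^d`
# (side vector `q + 1`), its block expectations and its `L_q`-periodicity

Topic `Literature/MathematicalPhysics/QuantumLattice` (family `hubbard`, model-free, general `d`). The rectangular twin of
`FermionBoxTilingProductState.lean` (hubbard-box-p1: cubic boxes `n·v + [0,n)^d`): the blocks are the RECTANGULAR boxes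
`B_v = ℓ_q(v) + [0, q+1)`, `ℓ_q(v) = Σ_i v_i (q_i+1) e_i` (`superlatVec q v`), every block carrying the SAME even density matrix
`ρ₀ ∈ 𝔄([0,q+1))` transported by the lattice translation — the state `⊗_{v ∈ ℤ^d} ρ₀` of Araki–Moriya / Bratteli–Robinson for an
`a × b` (`× …`) cell. Written for stage S2 of the Hubbard material-oracle programme (cell hubbard-fast, seat hubbard-box-p3): the
thermodynamic-limit CLUSTER VARIATIONAL PRINCIPLE for a general finite-range one-band model (`t–t′–t″`, decorated, strained) needs the
periodic product of an `a × b` open-cluster state (the kernel-checked cluster vectors of the tree are `2 × 4`, `2 × 3`, `4 × 3`), not only of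
cubes; the companion `ClusterProductStateEnergy.lean` computes its cell energy and filling.

* §1 the rectangle `halfOpenRect q = Π_i [0, q_i+1)`, its translates `shiftSet (superlatVec q v) (halfOpenRect q)`, the RECTANGULAR
  PARTITION `rectPartition d q` (class of `x` = `(⌊x_i/(q_i+1)⌋)_i`), `cls(x + ℓ_q(w)) = cls x + w`.
* §2 transport of `ρ₀` to every block (`rectBackEquiv`, `rectCopy`; trace / positivity / evenness preserved; translated reference
  observables keep their expectations `tr(Γ_{τ_{ℓ(v)}} A · rectCopy v) = tr(A ρ₀)`).
* §3 **`InfVolFermionState.rectTilingState q ρ₀ …`** `:= blockProductState (rectPartition d q) (rectCopy q ρ₀ ·)`: an EVEN state with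
  `ω(Γ_{τ_{ℓ(v)}} A) = tr(A ρ₀)` on every block (`rectTilingState_expect_shiftEmb`, `…_expect_box_zero`), block marginals `rectCopy v`,
  and the PRODUCT PROPERTY on two blocks `ω(Γ_i a · Γ_j b) = ω_i(a) ω_j(b)` (`rectTilingState_expect_mul_of_ne`), whence an ODD observable of
  one block times any observable of another has ZERO expectation (`rectTilingState_expect_mul_eq_zero_of_odd`) — the lemma that kills every
  hopping term straddling two clusters.
* §4 **PERIODICITY**: `(⊗_v ρ₀) ∘ τ_{ℓ_q(w)} = ⊗_v ρ₀` (`rectTilingState_shift_superlatVec`, uniqueness of block product states), hence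
  `rectTilingState_isPeriodic : IsPeriodic q` — so `PeriodicStatesCellAverage` / `PeriodicInteractionsCellEnergy` apply: the cell average is
  translation invariant and `tiGroundEnergyDensityAt Ψ R ρ̄ ≤ ē_q(⊗_v ρ₀)`.

Everything is PROVED; definitions with bodies (`halfOpenRect`, `rectPartition`, `rectBackEquiv`, `rectCopy`, `rectTilingState`,
`rectPartShiftEmb`), no named fact, no number, no `sorry`. HONEST SCOPE: pure bookkeeping of a product state; no energy is computed here.

## Tree / Mathlib search

REUSED (box-p1's block calculus, verbatim API): `BlockPartition`, `blockProductState(_expect_block/_expect_prod/_isEven)`, `rdm_blockProductState_block`,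
`eq_blockProductState_of_forall_prod`, `blockVal(_apply)`, `blockLoc`, `blockEmb`, `blockClasses`, `cls_mem_blockClasses` (`FermionBlockProductState`);
`fermionPartialTrace`, `trace_mul_fermionPartialTrace`, `posSemidef/parityAut_fermionPartialTrace(_of_even)`; `PolySite.pt/shiftEmb/incl`,
`fermionEmbed_fermionEmbed/_congr/_refl_apply`, `shift_expect`, `IsEven.expect_eq_zero_of_odd`-pattern; `superlatVec(_apply/_add)`, `periodVec`,
`IsPeriodic` (`PeriodicInteractionsCellEnergy`, `PeriodicStatesCellAverage`); `shiftSet`, `mem_shiftSet`; Mathlib `Fintype.piFinset`, `Int.add_mul_ediv_right`,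
`Int.ediv_lt_iff_lt_mul`, `Int.le_ediv_iff_mul_le`. `rg 'halfOpenRect|rectPartition|rectTiling'` (QuantumLattice): nothing — the cubic
`boxPartition/boxTilingState` are the only tilings by finite boxes in the tree (adapted from `FermionBoxTilingProductState.lean`, hubbard-box-p1).

## References

* O. Bratteli, D. W. Robinson, *OAQSM 2* (1997), Prop. 6.2.38 / Thm. 6.2.40 (periodic product states over a box tiling). [cite: BratteliRobinsonII1997, Thm. 6.2.40]
* H. Araki, H. Moriya, Rev. Math. Phys. 15 (2003) 93, §11.1 Thm. 11.2 (products of even states; uniqueness), §4.1 Def. 4.3/4.5. [cite: ArakiMoriya2003, §11.1 Theorem 11.2]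
* D. Ruelle, *Statistical Mechanics: Rigorous Results* (1969), §3.3 (cluster trial states). [cite: Ruelle1969, §3.3]
-/

noncomputable section

namespace Literature.MathematicalPhysics.QuantumLattice

open Matrix Finset HubbardWave0 Literature.Probability.LatticeModels ThermodynamicLimit
open scoped ComplexOrder BigOperators

variable {d : ℕ}

/-! ### §1. The rectangle `[0, q+1)` and the rectangular partition of `ℤ^d` -/

/-- **The half-open rectangle `Π_i [0, q_i+1) ⊆ ℤ^d`** (side vector `q + 1`; the fundamental cell of the superlattice
`L_q = ⊕_i (q_i+1)ℤe_i`, cf. `Cell q`). [cite: ArakiMoriya2003, §4.1 Def. 4.3] -/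
def halfOpenRect (q : Fin d → ℕ) : Finset (Site d) :=
  Fintype.piFinset fun i => Finset.Ico (0 : ℤ) ((q i : ℤ) + 1)

/-- Membership in the rectangle: every coordinate lies in `[0, q_i+1)`. [cite: ArakiMoriya2003, §4.1 Def. 4.3] -/
@[simp] theorem mem_halfOpenRect {q : Fin d → ℕ} {x : Site d} :
    x ∈ halfOpenRect q ↔ ∀ i, 0 ≤ x i ∧ x i < (q i : ℤ) + 1 := by
  simp [halfOpenRect, Fintype.mem_piFinset]

/-- `|[0,q+1)| = Π_i (q_i+1)` (= `|Cell q|`). [cite: ArakiMoriya2003, §4.1 Def. 4.3] -/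
theorem card_halfOpenRect (q : Fin d → ℕ) : #(halfOpenRect q) = ∏ i, (q i + 1) := by
  rw [halfOpenRect, Fintype.card_piFinset]
  refine Finset.prod_congr rfl fun i _ => ?_
  rw [Int.card_Ico]
  omega

/-- The cell positions are exactly the points of the rectangle. [cite: ArakiMoriya2003, §4.1 Def. 4.3] -/
theorem cellPos_mem_halfOpenRect {q : Fin d → ℕ} (c : Cell q) : cellPos c ∈ halfOpenRect q := by
  rw [mem_halfOpenRect]
  intro i
  have h : ((c i : ℕ)) < q i + 1 := (c i).isLt
  refine ⟨by simp [cellPos], ?_⟩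
  simp only [cellPos]
  exact_mod_cast h

/-- Membership in the translate `ℓ_q(v) + [0,q+1)`. [cite: ArakiMoriya2003, §4.1 Def. 4.3] -/
theorem mem_shiftSet_superlatVec_halfOpenRect {q : Fin d → ℕ} {v x : Site d} :
    x ∈ shiftSet (superlatVec q v) (halfOpenRect q) ↔
      ∀ i, v i * ((q i : ℤ) + 1) ≤ x i ∧ x i < v i * ((q i : ℤ) + 1) + ((q i : ℤ) + 1) := by
  rw [mem_shiftSet, mem_halfOpenRect]
  refine forall_congr' fun i => ?_
  simp only [Pi.sub_apply, superlatVec_apply]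
  constructor
  · rintro ⟨h1, h2⟩; constructor <;> omega
  · rintro ⟨h1, h2⟩; constructor <;> omega

/-- **The rectangular partition** of `ℤ^d` into the boxes `B_v = ℓ_q(v) + [0,q+1)`, `v ∈ ℤ^d`: the class of `x` is
`v = (⌊x_i/(q_i+1)⌋)_i`. Reducible, so that `block v` unfolds silently. [cite: BratteliRobinsonII1997, Thm. 6.2.40] -/
@[reducible] def rectPartition (d : ℕ) (q : Fin d → ℕ) : BlockPartition d (Site d) where
  cls x := fun i => x i / ((q i : ℤ) + 1)
  block v := shiftSet (superlatVec q v) (halfOpenRect q)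
  mem_block_iff v x := by
    rw [mem_shiftSet_superlatVec_halfOpenRect]
    constructor
    · intro h
      funext i
      have hq : (0 : ℤ) < (q i : ℤ) + 1 := by positivity
      obtain ⟨h1, h2⟩ := h i
      refine le_antisymm ?_ ((Int.le_ediv_iff_mul_le hq).2 (by linarith))
      have h3 : x i / ((q i : ℤ) + 1) < v i + 1 := (Int.ediv_lt_iff_lt_mul hq).2 (by linarith)
      omega
    · intro h i
      have hq : (0 : ℤ) < (q i : ℤ) + 1 := by positivity
      have hi : x i / ((q i : ℤ) + 1) = v i := congrFun h i
      constructor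
      · have := (Int.le_ediv_iff_mul_le hq).1 hi.ge
        linarith
      · have := (Int.ediv_lt_iff_lt_mul hq).1 (show x i / ((q i : ℤ) + 1) < v i + 1 by omega)
        linarith

/-- The class map of the rectangular partition (definitional). [cite: BratteliRobinsonII1997, Thm. 6.2.40] -/
theorem rectPartition_cls (q : Fin d → ℕ) (x : Site d) : (rectPartition d q).cls x = fun i => x i / ((q i : ℤ) + 1) := rfl

/-- The blocks of the rectangular partition (definitional). [cite: BratteliRobinsonII1997, Thm. 6.2.40] -/
theorem rectPartition_block (q : Fin d → ℕ) (v : Site d) :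
    (rectPartition d q).block v = shiftSet (superlatVec q v) (halfOpenRect q) := rfl

/-- **Translating by a superlattice vector shifts the class**: `cls(x + ℓ_q(w)) = cls x + w`. [cite: BratteliRobinsonII1997, Thm. 6.2.40] -/
theorem rectPartition_cls_add_superlatVec (q : Fin d → ℕ) (x w : Site d) :
    (rectPartition d q).cls (x + superlatVec q w) = (rectPartition d q).cls x + w := by
  funext i
  have hq : ((q i : ℤ) + 1) ≠ 0 := by positivity
  simp only [Pi.add_apply, superlatVec_apply]
  exact Int.add_mul_ediv_right (x i) (w i) hq

/-- The reference rectangle `[0,q+1)` is the block of class `0`. [cite: BratteliRobinsonII1997, Thm. 6.2.40] -/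
theorem rectPartition_block_zero (q : Fin d → ℕ) : (rectPartition d q).block 0 = halfOpenRect q := by
  rw [rectPartition_block]
  ext y
  rw [mem_shiftSet, superlatVec_zero, sub_zero]

/-- `ℓ_q(e_i) = periodVec q i`. [cite: ArakiMoriya2003, §4.1] -/
theorem superlatVec_single_one (q : Fin d → ℕ) (i : Fin d) : superlatVec q (Pi.single i 1 : Site d) = periodVec q i := by
  funext j
  rw [superlatVec_apply, periodVec]
  by_cases hj : j = i
  · subst hj; rw [Pi.single_eq_same, Pi.single_eq_same, one_mul]
  · rw [Pi.single_eq_of_ne hj, Pi.single_eq_of_ne hj, zero_mul]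

/-! ### §2. Transporting one box state to every block -/

/-- **The translation of the block `B_v = ℓ_q(v) + [0,q+1)` back onto the reference rectangle**, `x ↦ x − ℓ_q(v)`, as a bijection of
ordered site sets. [cite: ArakiMoriya2003, §4.1 Def. 4.3] -/
def rectBackEquiv (q : Fin d → ℕ) (v : Site d) :
    PolySite (shiftSet (superlatVec q v) (halfOpenRect q)) ≃ PolySite (halfOpenRect q) where
  toFun y := PolySite.pt (ofLex y.1 - superlatVec q v) (mem_shiftSet.1 (PolySite.ofLex_mem y))
  invFun z := PolySite.pt (ofLex z.1 + superlatVec q v) (PolySite.add_mem_shiftSet _ (PolySite.ofLex_mem z))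
  left_inv y := Subtype.ext (by
    change toLex (ofLex (PolySite.pt (ofLex y.1 - superlatVec q v) (mem_shiftSet.1 (PolySite.ofLex_mem y))).1 + superlatVec q v) = y.1
    rw [PolySite.ofLex_coe_pt, sub_add_cancel, toLex_ofLex])
  right_inv z := Subtype.ext (by
    change toLex (ofLex (PolySite.pt (ofLex z.1 + superlatVec q v) (PolySite.add_mem_shiftSet _ (PolySite.ofLex_mem z))).1 - superlatVec q v) = z.1
    rw [PolySite.ofLex_coe_pt, add_sub_cancel_right, toLex_ofLex])

/-- The underlying site of the back-translated site. [cite: ArakiMoriya2003, §4.1 Def. 4.3] -/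
@[simp] theorem ofLex_coe_rectBackEquiv (q : Fin d → ℕ) (v : Site d) (y : PolySite (shiftSet (superlatVec q v) (halfOpenRect q))) :
    ofLex (rectBackEquiv q v y).1 = ofLex y.1 - superlatVec q v := rfl

/-- Back-translation after translation is the identity. [cite: ArakiMoriya2003, §4.1 Def. 4.3] -/
theorem shiftEmb_trans_rectBackEquiv (q : Fin d → ℕ) (v : Site d) :
    (PolySite.shiftEmb (superlatVec q v) (halfOpenRect q)).trans (rectBackEquiv q v).toEmbedding = Function.Embedding.refl _ :=
  DFunLike.ext _ _ fun y => Subtype.ext (by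
    change toLex (ofLex (PolySite.shiftEmb (superlatVec q v) (halfOpenRect q) y).1 - superlatVec q v) = y.1
    rw [PolySite.ofLex_coe_shiftEmb, add_sub_cancel_right, toLex_ofLex])

/-- **The box state transported to the block `B_v`**: the density matrix `tr_{rectBack} ρ₀ ∈ 𝔄(B_v)` of the state
`A ↦ tr(Γ_{rectBack} A · ρ₀)`. [cite: BratteliRobinsonII1997, Thm. 6.2.40] -/
def rectCopy (q : Fin d → ℕ) (ρ₀ : FermionOp (halfOpenRect q)) (v : Site d) : FermionOp (shiftSet (superlatVec q v) (halfOpenRect q)) :=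
  fermionPartialTrace (rectBackEquiv q v).toEmbedding ρ₀

section Copy

variable (q : Fin d → ℕ) (ρ₀ : FermionOp (halfOpenRect q)) (v : Site d)

/-- Duality: `tr(A · rectCopy v) = tr(Γ_{rectBack} A · ρ₀)`. [cite: ArakiMoriya2003, §4.1 Def. 4.5] -/
theorem trace_mul_rectCopy (A : FermionOp (shiftSet (superlatVec q v) (halfOpenRect q))) :
    (A * rectCopy q ρ₀ v).trace = (fermionEmbed (rectBackEquiv q v).toEmbedding A * ρ₀).trace :=
  trace_mul_fermionPartialTrace _ _ _

/-- **Translated observables have the reference expectations**: `tr(Γ_{τ_{ℓ(v)}} A · rectCopy v) = tr(A ρ₀)`.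
[cite: ArakiMoriya2003, §4.1 Def. 4.3 and Def. 4.5] -/
theorem trace_fermionEmbed_shiftEmb_mul_rectCopy (A : FermionOp (halfOpenRect q)) :
    (fermionEmbed (PolySite.shiftEmb (superlatVec q v) (halfOpenRect q)) A * rectCopy q ρ₀ v).trace = (A * ρ₀).trace := by
  rw [trace_mul_rectCopy, fermionEmbed_fermionEmbed, shiftEmb_trans_rectBackEquiv, fermionEmbed_refl_apply]

/-- The transported state has the trace of `ρ₀`. [cite: ArakiMoriya2003, §4.1 Def. 4.5] -/
theorem trace_rectCopy : (rectCopy q ρ₀ v).trace = ρ₀.trace := trace_fermionPartialTrace _ _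

variable {ρ₀}

/-- The transported state is positive semidefinite. [cite: ArakiMoriya2003, §4.1 Def. 4.5] -/
theorem posSemidef_rectCopy (h : ρ₀.PosSemidef) : (rectCopy q ρ₀ v).PosSemidef := posSemidef_fermionPartialTrace _ h

/-- The transported state is Hermitian if `ρ₀` is. [cite: ArakiMoriya2003, §4.1 Def. 4.5] -/
theorem isHermitian_rectCopy (h : ρ₀.IsHermitian) : (rectCopy q ρ₀ v).IsHermitian := isHermitian_fermionPartialTrace _ h

/-- The transported state is even if `ρ₀` is. [cite: ArakiMoriya2003, §11.1 Lemma 11.1] -/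
theorem parityAut_rectCopy (h : parityAut ρ₀ = ρ₀) : parityAut (rectCopy q ρ₀ v) = rectCopy q ρ₀ v :=
  parityAut_fermionPartialTrace_of_even _ h

end Copy

/-! ### §3. The rectangular tiling state `⊗_{v ∈ ℤ^d} ρ₀` -/

namespace InfVolFermionState

section Tiling

variable (q : Fin d → ℕ) (ρ₀ : FermionOp (halfOpenRect q)) (hev : parityAut ρ₀ = ρ₀) (hpsd : ρ₀.PosSemidef) (htr : ρ₀.trace = 1)

/-- **THE RECTANGULAR TILING STATE `⊗_{v ∈ ℤ^d} ρ₀`**: the Araki–Moriya product over the tiling `B_v = ℓ_q(v) + [0,q+1)` of the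
transported copies of one even density matrix `ρ₀` on `[0,q+1)`. [cite: BratteliRobinsonII1997, Thm. 6.2.40] [cite: ArakiMoriya2003, §11.1 Theorem 11.2] -/
def rectTilingState : InfVolFermionState d :=
  blockProductState (rectPartition d q) (fun v => rectCopy q ρ₀ v) (fun v => parityAut_rectCopy q v hev)
    (fun v => posSemidef_rectCopy q v hpsd) (fun v => (trace_rectCopy q ρ₀ v).trans htr)

/-- Unfolding. [cite: BratteliRobinsonII1997, Thm. 6.2.40] -/
theorem rectTilingState_def : rectTilingState q ρ₀ hev hpsd htr =
    blockProductState (rectPartition d q) (fun v => rectCopy q ρ₀ v) (fun v => parityAut_rectCopy q v hev)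
      (fun v => posSemidef_rectCopy q v hpsd) (fun v => (trace_rectCopy q ρ₀ v).trans htr) := rfl

/-- **The tiling state on translated reference observables**: `ω_{B_v}(Γ_{τ_{ℓ(v)}} A) = tr(A ρ₀)` for every `A ∈ 𝔄([0,q+1))`.
[cite: BratteliRobinsonII1997, Thm. 6.2.40] -/
theorem rectTilingState_expect_shiftEmb (v : Site d) (A : FermionOp (halfOpenRect q)) :
    (rectTilingState q ρ₀ hev hpsd htr).expect (shiftSet (superlatVec q v) (halfOpenRect q))
      (fermionEmbed (PolySite.shiftEmb (superlatVec q v) (halfOpenRect q)) A) = (A * ρ₀).trace := by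
  have h := blockProductState_expect_block (rectPartition d q) (fun v => rectCopy q ρ₀ v) (fun v => parityAut_rectCopy q v hev)
    (fun v => posSemidef_rectCopy q v hpsd) (fun v => (trace_rectCopy q ρ₀ v).trans htr) v
    (fermionEmbed (PolySite.shiftEmb (superlatVec q v) (halfOpenRect q)) A)
  rw [trace_fermionEmbed_shiftEmb_mul_rectCopy] at h
  exact h

/-- On the reference rectangle itself: `ω_{[0,q+1)}(A) = tr(A ρ₀)`. [cite: BratteliRobinsonII1997, Thm. 6.2.40] -/
theorem rectTilingState_expect_box_zero (A : FermionOp (halfOpenRect q)) :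
    (rectTilingState q ρ₀ hev hpsd htr).expect (halfOpenRect q) A = (A * ρ₀).trace := by
  have hsub : halfOpenRect q ⊆ shiftSet (superlatVec q (0 : Site d)) (halfOpenRect q) := fun y hy => by
    rw [mem_shiftSet, superlatVec_zero, sub_zero]; exact hy
  rw [← (rectTilingState q ρ₀ hev hpsd htr).compatible hsub A]
  have h : fermionEmbed (PolySite.incl hsub) A = fermionEmbed (PolySite.shiftEmb (superlatVec q (0 : Site d)) (halfOpenRect q)) A :=
    congrFun (congrArg DFunLike.coe (fermionEmbed_congr fun y => Subtype.ext (by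
      change y.1 = toLex (ofLex y.1 + superlatVec q (0 : Site d))
      rw [superlatVec_zero, add_zero, toLex_ofLex]))) A
  rw [h, rectTilingState_expect_shiftEmb]

/-- **The tiling state on the box Hamiltonians of a translation-covariant interaction**: `ω(H_{B_v}) = tr(H_{[0,q+1)} ρ₀)`.
[cite: BratteliRobinsonII1997, Thm. 6.2.40] -/
theorem rectTilingState_expect_localHamiltonian {Ψ : FermionInteraction d} (hT : Ψ.IsTranslationInvariant) (v : Site d) :
    (rectTilingState q ρ₀ hev hpsd htr).expect (shiftSet (superlatVec q v) (halfOpenRect q))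
      (Ψ.localHamiltonian (shiftSet (superlatVec q v) (halfOpenRect q))) = (Ψ.localHamiltonian (halfOpenRect q) * ρ₀).trace := by
  rw [← hT.fermionEmbed_shiftEmb_localHamiltonian, rectTilingState_expect_shiftEmb]

/-- **The marginal of the tiling state on the block `B_v` is the transported copy of `ρ₀`.** [cite: ArakiMoriya2003, §11.1 Theorem 11.2] -/
theorem rdm_rectTilingState_box (v : Site d) :
    (rectTilingState q ρ₀ hev hpsd htr).rdm (shiftSet (superlatVec q v) (halfOpenRect q)) = rectCopy q ρ₀ v :=
  rdm_blockProductState_block (rectPartition d q) (fun v => rectCopy q ρ₀ v) (fun v => parityAut_rectCopy q v hev)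
    (fun v => posSemidef_rectCopy q v hpsd) (fun v => (trace_rectCopy q ρ₀ v).trans htr) v

/-- The tiling state is even. [cite: ArakiMoriya2003, §11.1 Theorem 11.2 Remark 2] -/
theorem rectTilingState_isEven : (rectTilingState q ρ₀ hev hpsd htr).IsEven :=
  blockProductState_isEven _ _ _ _ _

/-- **PRODUCT PROPERTY ON TWO BLOCKS**: for a region `Λ` and two distinct classes `i ≠ j`,
`ω(Γ_{Λ,i} a · Γ_{Λ,j} b) = tr(…a… · ρ_i) · tr(…b… · ρ_j)` — the expectation of a product of observables of two different blocks
factorises into the block values. [cite: ArakiMoriya2003, §11.1 Theorem 11.2 eq. (11.4)] -/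
theorem rectTilingState_expect_mul_of_ne (Λ : Finset (Site d)) {i j : Site d} (hij : i ≠ j)
    (hΛ : ∀ k ∈ (rectPartition d q).blockClasses Λ, k = i ∨ k = j)
    (a : FermionOp ((rectPartition d q).blockLoc Λ i)) (b : FermionOp ((rectPartition d q).blockLoc Λ j)) :
    (rectTilingState q ρ₀ hev hpsd htr).expect Λ
        (fermionEmbed ((rectPartition d q).blockEmb Λ i) a * fermionEmbed ((rectPartition d q).blockEmb Λ j) b) =
      blockVal (rectPartition d q) (fun v => rectCopy q ρ₀ v) i ((rectPartition d q).blockLoc_subset_block Λ i) a *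
        blockVal (rectPartition d q) (fun v => rectCopy q ρ₀ v) j ((rectPartition d q).blockLoc_subset_block Λ j) b := by
  classical
  -- the family of block observables: `a` on class `i`, `b` on class `j`
  let c : (k : Site d) → FermionOp ((rectPartition d q).blockLoc Λ k) := fun k =>
    if hk : k = i then hk ▸ a else if hk' : k = j then hk' ▸ b else 1
  have hci : c i = a := by simp [c]
  have hcj : c j = b := by simp [c, hij.symm]
  have hl : [i, j].Nodup := List.nodup_cons.2 ⟨by simpa using hij, List.nodup_singleton j⟩
  have hΛl : ∀ k ∈ (rectPartition d q).blockClasses Λ, k ∈ [i, j] := fun k hk => by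
    rcases hΛ k hk with rfl | rfl <;> simp
  have h := blockProductState_expect_prod (rectPartition d q) (fun v => rectCopy q ρ₀ v) (fun v => parityAut_rectCopy q v hev)
    (fun v => posSemidef_rectCopy q v hpsd) (fun v => (trace_rectCopy q ρ₀ v).trans htr) Λ [i, j] hl hΛl c
  simp only [List.map_cons, List.map_nil, List.prod_cons, List.prod_nil, mul_one, hci, hcj] at h
  rw [rectTilingState_def]
  exact h

/-- **An ODD observable of one block times ANY observable of another block has ZERO expectation** in the tiling state (the block
states are even: `tr(a ρ_i) = 0` for `Θ a = −a`). This is what kills every hopping term `c†_{xσ} c_{yσ}` joining two different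
clusters. [cite: ArakiMoriya2003, §4.1 eq. (4.8) and §11.1 Theorem 11.2] -/
theorem rectTilingState_expect_mul_eq_zero_of_odd (Λ : Finset (Site d)) {i j : Site d} (hij : i ≠ j)
    (hΛ : ∀ k ∈ (rectPartition d q).blockClasses Λ, k = i ∨ k = j)
    {a : FermionOp ((rectPartition d q).blockLoc Λ i)} (ha : parityAut a = -a) (b : FermionOp ((rectPartition d q).blockLoc Λ j)) :
    (rectTilingState q ρ₀ hev hpsd htr).expect Λ
        (fermionEmbed ((rectPartition d q).blockEmb Λ i) a * fermionEmbed ((rectPartition d q).blockEmb Λ j) b) = 0 := by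
  rw [rectTilingState_expect_mul_of_ne q ρ₀ hev hpsd htr Λ hij hΛ a b, blockVal_apply]
  -- the block value of an odd observable under an even density matrix vanishes
  rw [trace_mul_eq_zero_of_odd_of_even (by rw [← fermionEmbed_parityAut, ha, map_neg]) (parityAut_rectCopy q i hev), zero_mul]

/-! ### §4. Periodicity under the superlattice `L_q` -/

/-- The translation by `ℓ_q(w)` restricted to a part: `Λ ∩ B_{j−w} → (Λ + ℓ_q(w)) ∩ B_j`, `x ↦ x + ℓ_q(w)`. [cite: ArakiMoriya2003, §4.1 Def. 4.3] -/
def rectPartShiftEmb (w : Site d) (Λ : Finset (Site d)) (j : Site d) :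
    PolySite ((rectPartition d q).blockLoc Λ (j - w)) ↪ PolySite ((rectPartition d q).blockLoc (shiftSet (superlatVec q w) Λ) j) :=
  ⟨fun y => PolySite.pt (ofLex y.1 + superlatVec q w) (by
      have hy := (rectPartition d q).mem_blockLoc.1 (PolySite.ofLex_mem y)
      refine (rectPartition d q).mem_blockLoc.2 ⟨PolySite.add_mem_shiftSet _ hy.1, ?_⟩
      rw [rectPartition_cls_add_superlatVec, hy.2, sub_add_cancel]),
    fun y y' h => Subtype.ext (by
      have h1 := congrArg (fun z : PolySite ((rectPartition d q).blockLoc (shiftSet (superlatVec q w) Λ) j) => ofLex z.1) h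
      simp only [PolySite.ofLex_coe_pt, add_left_inj] at h1
      exact congrArg toLex h1)⟩

/-- Underlying site of the shifted part site. [cite: ArakiMoriya2003, §4.1 Def. 4.3] -/
@[simp] theorem ofLex_coe_rectPartShiftEmb (w : Site d) (Λ : Finset (Site d)) (j : Site d)
    (y : PolySite ((rectPartition d q).blockLoc Λ (j - w))) :
    ofLex (rectPartShiftEmb q w Λ j y).1 = ofLex y.1 + superlatVec q w := rfl

/-- **Translating a part-embedded observable by `ℓ_q(w)`** lands in the part of class `j = i + w` of the translated region.
[cite: ArakiMoriya2003, §4.1 Def. 4.3] -/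
theorem fermionEmbed_shiftEmb_rectBlockEmb (w : Site d) (Λ : Finset (Site d)) (j : Site d)
    (a : FermionOp ((rectPartition d q).blockLoc Λ (j - w))) :
    fermionEmbed (PolySite.shiftEmb (superlatVec q w) Λ) (fermionEmbed ((rectPartition d q).blockEmb Λ (j - w)) a) =
      fermionEmbed ((rectPartition d q).blockEmb (shiftSet (superlatVec q w) Λ) j) (fermionEmbed (rectPartShiftEmb q w Λ j) a) := by
  rw [fermionEmbed_fermionEmbed, fermionEmbed_fermionEmbed]
  exact congrFun (congrArg DFunLike.coe (fermionEmbed_congr fun y => Subtype.ext rfl)) a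

/-- **Block values are translation covariant**: the value of block `j` on the translated observable equals the value of block `j − w`
on the original one. [cite: ArakiMoriya2003, §4.1 Def. 4.3 and Def. 4.5] -/
theorem blockVal_rectCopy_shift (w : Site d) (Λ : Finset (Site d)) (j : Site d)
    (a : FermionOp ((rectPartition d q).blockLoc Λ (j - w))) :
    blockVal (rectPartition d q) (fun v => rectCopy q ρ₀ v) j
        ((rectPartition d q).blockLoc_subset_block (shiftSet (superlatVec q w) Λ) j) (fermionEmbed (rectPartShiftEmb q w Λ j) a) =
      blockVal (rectPartition d q) (fun v => rectCopy q ρ₀ v) (j - w) ((rectPartition d q).blockLoc_subset_block Λ (j - w)) a := by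
  rw [blockVal_apply, blockVal_apply]
  change (_ * rectCopy q ρ₀ j).trace = (_ * rectCopy q ρ₀ (j - w)).trace
  rw [rectCopy, rectCopy, trace_mul_fermionPartialTrace, trace_mul_fermionPartialTrace, fermionEmbed_fermionEmbed,
    fermionEmbed_fermionEmbed, fermionEmbed_fermionEmbed]
  congr 2
  exact congrFun (congrArg DFunLike.coe (fermionEmbed_congr fun y => Subtype.ext (by
    change toLex (ofLex y.1 + superlatVec q w - superlatVec q j) = toLex (ofLex y.1 - superlatVec q (j - w))
    have hv : superlatVec q (j - w) = superlatVec q j - superlatVec q w := funext fun i => by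
      simp only [superlatVec_apply, Pi.sub_apply]; ring
    rw [hv]
    congr 1
    abel))) a

/-- **PERIODICITY OF THE TILING STATE**: `(⊗_v ρ₀) ∘ τ_{ℓ_q(w)} = ⊗_v ρ₀` for every `w ∈ ℤ^d` (uniqueness of the block product state: the
translated state has the same block marginals and the product property). [cite: BratteliRobinsonII1997, Thm. 6.2.40]
[cite: ArakiMoriya2003, §11.1 Theorem 11.2 (uniqueness)] -/
theorem rectTilingState_shift_superlatVec (w : Site d) :
    (rectTilingState q ρ₀ hev hpsd htr).shift (superlatVec q w) = rectTilingState q ρ₀ hev hpsd htr := by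
  refine eq_blockProductState_of_forall_prod (rectPartition d q) (fun v => rectCopy q ρ₀ v) (fun v => parityAut_rectCopy q v hev)
    (fun v => posSemidef_rectCopy q v hpsd) (fun v => (trace_rectCopy q ρ₀ v).trans htr) fun Λ l hl hΛl a => ?_
  rw [shift_expect, map_list_prod, List.map_map]
  set a' : (j : Site d) → FermionOp ((rectPartition d q).blockLoc (shiftSet (superlatVec q w) Λ) j) :=
    fun j => fermionEmbed (rectPartShiftEmb q w Λ j) (a (j - w)) with ha'
  have hterm : ∀ i, fermionEmbed (PolySite.shiftEmb (superlatVec q w) Λ) (fermionEmbed ((rectPartition d q).blockEmb Λ i) (a i)) =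
      fermionEmbed ((rectPartition d q).blockEmb (shiftSet (superlatVec q w) Λ) (i + w)) (a' (i + w)) := by
    intro i
    have key : ∀ j i, i = j - w →
        fermionEmbed (PolySite.shiftEmb (superlatVec q w) Λ) (fermionEmbed ((rectPartition d q).blockEmb Λ i) (a i)) =
          fermionEmbed ((rectPartition d q).blockEmb (shiftSet (superlatVec q w) Λ) j) (a' j) := by
      rintro j i rfl
      exact fermionEmbed_shiftEmb_rectBlockEmb q w Λ j (a (j - w))
    exact key (i + w) i (by rw [add_sub_cancel_right])
  have hlist : (l.map (⇑(fermionEmbed (PolySite.shiftEmb (superlatVec q w) Λ)) ∘ fun i => fermionEmbed ((rectPartition d q).blockEmb Λ i) (a i))) =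
      (l.map (· + w)).map fun j => fermionEmbed ((rectPartition d q).blockEmb (shiftSet (superlatVec q w) Λ) j) (a' j) := by
    rw [List.map_map]
    exact List.map_congr_left fun i _ => hterm i
  rw [hlist]
  have hl' : (l.map (· + w)).Nodup := hl.map (add_left_injective w)
  have hΛl' : ∀ j ∈ (rectPartition d q).blockClasses (shiftSet (superlatVec q w) Λ), j ∈ l.map (· + w) := by
    intro j hj
    obtain ⟨y, hy, hyj⟩ := Finset.mem_image.1 hj
    have hy' : y - superlatVec q w ∈ Λ := mem_shiftSet.1 hy
    have hcls : (rectPartition d q).cls (y - superlatVec q w) = j - w := by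
      have h := rectPartition_cls_add_superlatVec q (y - superlatVec q w) w
      rw [sub_add_cancel] at h
      rw [eq_sub_iff_add_eq, ← h, hyj]
    refine List.mem_map.2 ⟨j - w, hΛl _ ?_, sub_add_cancel j w⟩
    rw [← hcls]
    exact (rectPartition d q).cls_mem_blockClasses hy'
  rw [rectTilingState_def, blockProductState_expect_prod (rectPartition d q) _ _ _ _ _ _ hl' hΛl' a', List.map_map]
  refine congrArg List.prod (List.map_congr_left fun i _ => ?_)
  have key : ∀ j i, i = j - w →
      blockVal (rectPartition d q) (fun v => rectCopy q ρ₀ v) j ((rectPartition d q).blockLoc_subset_block (shiftSet (superlatVec q w) Λ) j) (a' j) =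
        blockVal (rectPartition d q) (fun v => rectCopy q ρ₀ v) i ((rectPartition d q).blockLoc_subset_block Λ i) (a i) := by
    rintro j i rfl
    exact blockVal_rectCopy_shift q ρ₀ w Λ j (a (j - w))
  exact key (i + w) i (by rw [add_sub_cancel_right])

/-- **The tiling state is `L_q`-periodic.** [cite: BratteliRobinsonII1997, Thm. 6.2.40] -/
theorem rectTilingState_isPeriodic : (rectTilingState q ρ₀ hev hpsd htr).IsPeriodic q := fun i => by
  rw [← superlatVec_single_one q i]
  exact rectTilingState_shift_superlatVec q ρ₀ hev hpsd htr _

/-- Hence its cell average over `Cell q` is TRANSLATION INVARIANT. [cite: BratteliRobinsonI1987, §4.3.1] -/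
theorem isTranslationInvariant_cellAverage_rectTilingState :
    ((rectTilingState q ρ₀ hev hpsd htr).cellAverage q).IsTranslationInvariant :=
  (rectTilingState_isPeriodic q ρ₀ hev hpsd htr).isTranslationInvariant_cellAverage

end Tiling

end InfVolFermionState

end Literature.MathematicalPhysics.QuantumLattice

end
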